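import Summits.SmoothPoincare4.SmoothPoincare4.Theorems.ConvexBisectionAcyclicBisectionExistsComplementPieceGluing
import Literature.Topology.FourManifolds.CorkDecomposition
import Literature.Topology.FourManifolds.RegularDomainMaps
import HarnessLib

/-!
# The complement piece `W₂`, VI: `M' = X₁ ∪_φ W₂` with `W₂ = {Φ ≤ 0}` a regular sublevel set of Milnor's gluing
(helper file 6 of the wave-4 brick T3b (iii) "the complement piece `W₂ = {Φ ≤ 0}` of the pushed
prefix sub-handlebody inside Milnor's gluing" for stub `stub_steinRealisation` (NF6), line
`modp-braid-orbits` r11, crux `ConvexBisection.AcyclicBisectionExists`, item stmt-SmoothPoincare4-10508;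
lead c5, worker Y6)

Setting (V5-REPORT §3): `X = B ∪ (handles)` with data `D`, an injective sub-family `f : ι' → ι` (the
suffix), `M' = X ∪_Ψ W = G.d₂.Glued` Milnor's gluing with `G.CM` adapted to the belt maps of the handles
`f j` (`CollarAdapted`, from `exists_standardForm`), and the level function `Φ = levelFn D f G a κ δ` of
files I–V (`0` a regular value; signs computed in file V).  The pushed prefix sub-handlebody enters
ABSTRACTLY through the clause list of Y5's `helper_exists_pushedPrefixEmbedding`: a compact `X₁` and a
smooth embedding `jX₁ : X₁ → M'` with (H1) `range jX₁ ⊆ j_M (X)`, (H2) every `j_M y` with `y` off the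
handle charts `D.jB (f j)` is hit, (H3) in the `j`-th handle chart exactly the points with `0 < ‖b_λ‖²`
and `0 ≤ modelH κ δ b` are hit (Z2's model function).

* §1 `levelFn_nonneg_iff_mem_range`: `{0 ≤ Φ} = range jX₁`.
* §2 the T2 template (`…SplitComplement.lean`) made generic: an embedding of a compact `X₁` onto a
  regular superlevel set `{0 ≤ Φ}` is a diffeomorphism onto it (`exists_supDiffeo`:
  `HalfSliceAtlas.contMDiff_codRestrict`, `ContMDiffAt.iff_comp_isImmersionAt`), whence Milnor's splitting
  `M' = {Φ ≤ 0} ∪ {Φ ≥ 0}` (`RegularSublevel.isBoundaryGluing_split`, Milnor 1963 Thm. 3.1) reads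
  `M' = X₁ ∪_φ W₂`, `W₂ := {Φ ≤ 0}`, with the EXPLICIT witnesses `jX₁` and the inclusion of `W₂`, the seam
  identity `incl (b₂.incl (φ z)) = jX₁ (∂X₁.incl z)` and the gluing relation (`exists_gluing`).
* §3 **`helper_exists_complementPiece`** (registered) and the full export `exists_complementPiece`:
  the complement piece `W₂` (compact smooth `4`-manifold with boundary, `T2`, second countable), `b₂`,
  `jW₂`, `φ` with conjunct 1 `IsBoundaryGluing (∂X₁) b₂ φ (𝓡 4) M'` AND the export clauses for bricks
  (iv)–(v): `jW₂` a smooth embedding, cover, gluing relation with witnesses, seam identity,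
  `range jW₂ = j_N (W) ∪ ⋃ⱼ j_M (D.jB (f j) {modelH ≤ 0})`, membership tests in the handle charts and off
  them, and the universal property (smooth maps into `M'` with values in `range jW₂` lift smoothly).

Everything here is proved; no named facts.

## References
* J. Milnor, *Morse theory* (1963), Thm. 3.1. [Milnor1963]
* R. İ. Baykur, *Kähler decomposition of 4-manifolds*, AGT 6 (2006), proof of Thm. 5.1. [Baykur2006]
* M. W. Hirsch, *Differential Topology* (1976), §8.2. [HirschDT1976]
* J. M. Lee, *Introduction to Smooth Manifolds* (2013), Prop. 5.49, Cor. 5.30. [LeeSmoothManifolds2013]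
-/

noncomputable section

-- the prescribed namespace `Summit.<P>.<Sub>.…` duplicates `SmoothPoincare4` (P = Sub)
set_option linter.dupNamespace false

open scoped Manifold ContDiff Topology

namespace Summit.SmoothPoincare4.SmoothPoincare4.Theorems.AcyclicBisectionExists.ModpBraidOrbits

open Set Function Metric Filter Topology
open Literature.Topology.FourManifolds Literature.Topology.FourManifolds.HandleAttachingMap

/-! ### §1 `{0 ≤ Φ}` is the range of the pushed prefix embedding -/

section Range

variable {B : Type} [TopologicalSpace B] [T2Space B] [ChartedSpace (EuclideanHalfSpace 4) B]
  {ι : Type} [Finite ι] {h : ι → HandleAttachingMap 3 2 B}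
  {X : Type} [TopologicalSpace X] [ChartedSpace (EuclideanHalfSpace 4) X] [IsManifold (𝓡∂ 4) ∞ X]
  (D : MultiAttachmentData h (𝓡∂ 4) X) {ι' : Type} [Finite ι'] (f : ι' → ι)
  {bX : BoundaryData (𝓡∂ 4) X (𝓡 3)}
  {W : Type} [TopologicalSpace W] [ChartedSpace (EuclideanHalfSpace 4) W]
  [IsManifold (𝓡∂ 4) ∞ W] {bW : BoundaryData (𝓡∂ 4) W (𝓡 3)} [Nonempty bX.carrier]
  (G : BoundaryGlueData bX bW) {a κ δ : ℝ} {X₁ : Type} {jX₁ : X₁ → G.d₂.Glued}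

omit [Finite ι'] in
/-- **`{0 ≤ Φ} = range jX₁`** for a map `jX₁` satisfying the clauses (H1)–(H3) of the pushed prefix
embedding. [cite: Milnor1963, Thm. 3.1] -/
theorem levelFn_nonneg_iff_mem_range (ha : 0 < a) (hf : Injective f) (hCM : ∀ j, CollarAdapted D (f j) G a)
    (hκ : 0 < κ) (hκ2 : κ ≤ 1 / 2) (hδ : 0 < δ) (hδ2 : δ ≤ 1 / 2)
    (H1 : range jX₁ ⊆ range G.jM)
    (H2 : ∀ y : X, (∀ (j : ι') (b : ↥(beltPiece 3 2)), D.jB (f j) b ≠ y) → G.jM y ∈ range jX₁)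
    (H3 : ∀ (j : ι') (b : ↥(beltPiece 3 2)), G.jM (D.jB (f j) b) ∈ range jX₁ ↔
      0 < ‖lamPart ((b : closedBall (0 : EuclideanSpace ℝ (Fin 4)) 1) : EuclideanSpace ℝ (Fin 4))‖ ^ 2 ∧
        0 ≤ modelH κ δ ((b : closedBall (0 : EuclideanSpace ℝ (Fin 4)) 1) : EuclideanSpace ℝ (Fin 4)))
    (p : G.d₂.Glued) : 0 ≤ levelFn D f G a κ δ p ↔ p ∈ range jX₁ := by
  -- reduce to points `jM y`
  have key : ∀ y : X, 0 ≤ levelFn D f G a κ δ (G.jM y) ↔ G.jM y ∈ range jX₁ := by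
    intro y
    by_cases hy : ∃ (j : ι') (b : ↥(beltPiece 3 2)), D.jB (f j) b = y
    · obtain ⟨j, b, rfl⟩ := hy
      rw [levelFn_jM_jB_nonneg_iff D f G ha hf hCM hκ hκ2 hδ hδ2, H3]
      exact ⟨fun hH => ⟨lamPart_sq_pos_of_modelH_nonneg hκ hδ hH, hH⟩, fun h' => h'.2⟩
    · push Not at hy
      rw [levelFn_jM_of_forall_ne D f G ha hCM hκ hκ2 hy]
      exact ⟨fun _ => H2 y hy, fun _ => collarHeightFn_nonneg' _ y⟩
  have hcov : p ∈ range G.jM ∪ range G.jN := by rw [G.range_jM_union_range_jN]; exact mem_univ _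
  rcases hcov with ⟨y, rfl⟩ | ⟨c, rfl⟩
  · exact key y
  · rcases BoundaryGlueData.exists_incl_or_isInteriorPoint (bM := bW) c with ⟨w, rfl⟩ | hc
    · rw [G.jN_incl, ← G.jM_incl]
      exact key _
    · refine ⟨fun h0 => absurd h0 (not_le.2 (levelFn_jN_neg D f G ha hf hCM hκ hκ2 hδ hδ2 hc)), fun hp => ?_⟩
      obtain ⟨y, hy⟩ := H1 hp
      exact absurd hy (jM_ne_jN_of_isInteriorPoint G y hc)

omit [IsManifold (𝓡∂ 4) ∞ X] in
/-- **Clause (H2) from clause (c') of `helper_exists_pushedPrefixEmbedding`**: if `X = X₁ ∪_g (handles)`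
with data `D₂` whose handle charts are the charts `D.jB (f j)` and a point `D₂.jA c` is hit by `jX₁` as soon
as all its tube preimages have `0 ≤ H ∘ α`, then every point `j_M y` with `y` off the handle charts
`D.jB (f j)` is hit (such a `y = D₂.jA c` has no tube preimage off the attaching circle by Kosinski's
gluing relation, and none on it since `c` is off the cores). [cite: Kosinski1993, VI §6] -/
theorem jM_mem_range_of_forall_ne {X₁ : Type} [TopologicalSpace X₁] [T2Space X₁]
    [ChartedSpace (EuclideanHalfSpace 4) X₁] {g : ι' → HandleAttachingMap 3 2 X₁}
    (D₂ : MultiAttachmentData g (𝓡∂ 4) X) (hjB : ∀ (j : ι') (b : ↥(beltPiece 3 2)), D₂.jB j b = D.jB (f j) b)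
    {N : Type} (jM : X → N) {jX₁ : X₁ → N}
    (hc' : ∀ c : ↥(coresComplement g), jM (D₂.jA c) ∈ range jX₁ ↔
      ∀ (j : ι') (y : ↥(handleTube 3 2)), (g j).toFun y = (c : X₁) →
        0 ≤ modelH κ δ (handleInversion 2 ((y : closedBall (0 : EuclideanSpace ℝ (Fin 4)) 1) : EuclideanSpace ℝ (Fin 4))))
    {y : X} (hy : ∀ (j : ι') (b : ↥(beltPiece 3 2)), D.jB (f j) b ≠ y) : jM y ∈ range jX₁ := by
  rcases D₂.mem_range_or y with ⟨c, rfl⟩ | ⟨j, b, rfl⟩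
  · refine (hc' c).2 fun j y' hy' => ?_
    exfalso
    by_cases hS : lamSq 2 (((y' : closedBall (0 : EuclideanSpace ℝ (Fin 4)) 1) : EuclideanSpace ℝ (Fin 4))) = 1
    · exact (mem_coresComplement g).1 c.2 j (((g j).mem_core_iff).2 ⟨y', hS, hy'⟩)
    · set b : ↥(beltPiece 3 2) :=
        ⟨(handleInversionPt (y' : closedBall (0 : EuclideanSpace ℝ (Fin 4)) 1) y'.2 hS : ↥(handleTube 3 2)),
          (handleInversion_mem y'.2 hS).2.2⟩ with hb
      have hrel : (g j).glueRel (c : X₁) (b : closedBall (0 : EuclideanSpace ℝ (Fin 4)) 1) := by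
        rw [← hy']
        exact (g j).glueRel_apply y' hS
      have h1 : D₂.jA c = D₂.jB j b := (D₂.glue j c b).2 hrel
      exact hy j b (by rw [← hjB, ← h1])
  · exact absurd rfl (hy j b ∘ fun h' => (hjB j b).symm.trans h')

end Range

/-! ### §2 An embedding onto a regular superlevel set; the gluing with explicit witnesses -/

section Generic

variable {M' : Type} [TopologicalSpace M'] [T2Space M'] [ChartedSpace (EuclideanSpace ℝ (Fin 4)) M']
  [IsManifold (𝓡 4) ∞ M'] {Φ : M' → ℝ} (hΦ : IsRegularLevel (𝓡 4) Φ 0)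
  {X₁ : Type} [TopologicalSpace X₁] [CompactSpace X₁] [ChartedSpace (EuclideanHalfSpace 4) X₁]
  [IsManifold (𝓡∂ 4) ∞ X₁] {jX₁ : X₁ → M'}

omit [IsManifold (𝓡∂ 4) ∞ X₁] in
/-- **An embedding of a compact `X₁` onto the regular superlevel set `{0 ≤ Φ}` is a diffeomorphism onto
it** (smooth into the regular domain by `HalfSliceAtlas.contMDiff_codRestrict`; the inverse is continuous
as the inverse of a continuous bijection from a compact to a Hausdorff space, and smooth because its
composite with the immersion `jX₁` is the inclusion, `ContMDiffAt.iff_comp_isImmersionAt`).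
[cite: LeeSmoothManifolds2013, Prop. 5.49] -/
theorem exists_supDiffeo (hemb : Manifold.IsSmoothEmbedding (𝓡∂ 4) (𝓡 4) ∞ jX₁)
    (hsub : ∀ p, 0 ≤ Φ p ↔ p ∈ range jX₁) :
    ∃ e : X₁ ≃ₘ⟮𝓡∂ 4, 𝓡∂ 4⟯ RegularSuperlevel hΦ, ∀ x, RegularSublevel.incl hΦ.const_sub (e x) = jX₁ x := by
  have hmem : ∀ x, (fun y => 0 - Φ y) (jX₁ x) ≤ 0 := fun x =>
    (level_le_iff_const_sub_nonpos _).1 ((hsub _).2 ⟨x, rfl⟩)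
  set F : X₁ → RegularSuperlevel hΦ := fun x => RegularSublevel.mk _ (jX₁ x) (hmem x) with hF
  have hFi : ∀ x, RegularSublevel.incl hΦ.const_sub (F x) = jX₁ x := fun x => rfl
  have hsm : ContMDiff (𝓡∂ 4) (𝓡∂ 4) ∞ F :=
    (RegularSublevel.halfSliceAtlas hΦ.const_sub).contMDiff_codRestrict hmem hemb.contMDiff
  have hbij : Bijective F := by
    refine ⟨fun x y hxy => hemb.isEmbedding.injective ?_, fun s => ?_⟩
    · rw [← hFi x, ← hFi y, hxy]
    · have hs : 0 ≤ Φ (RegularSublevel.incl _ s) :=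
        (level_le_iff_const_sub_nonpos _).2 (RegularSublevel.apply_incl_le _ s)
      obtain ⟨x, hx⟩ := (hsub _).1 hs
      exact ⟨x, RegularSublevel.injective_incl _ (by rw [hFi, hx])⟩
  set e : X₁ ≃ RegularSuperlevel hΦ := Equiv.ofBijective F hbij with he
  have hcont : Continuous e.symm := (hsm.continuous.homeoOfEquivCompactToT2 (f := e)).symm.continuous
  have hsymm : ContMDiff (𝓡∂ 4) (𝓡∂ 4) ∞ e.symm := by
    intro s
    rw [ContMDiffAt.iff_comp_isImmersionAt (hemb.isImmersion.isImmersionAt _)]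
    refine ⟨hcont.continuousAt, ?_⟩
    have heq : jX₁ ∘ e.symm = RegularSublevel.incl hΦ.const_sub := funext fun s => by
      show RegularSublevel.incl hΦ.const_sub (e (e.symm s)) = _
      rw [e.apply_symm_apply]
    rw [heq]
    exact RegularSublevel.contMDiff_incl _ s
  exact ⟨{ toEquiv := e, contMDiff_toFun := hsm, contMDiff_invFun := hsymm }, fun x => rfl⟩

/-- **`M' = X₁ ∪_φ {Φ ≤ 0}` with explicit witnesses**: for a smooth embedding `jX₁` of a compact `X₁`
with `range jX₁ = {0 ≤ Φ}` (`0` a regular value), Milnor's splitting along the level transported along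
`X₁ ≅ {0 ≤ Φ}` gives a diffeomorphism `φ : ∂X₁ ≅ ∂{Φ ≤ 0}` such that `jX₁` and the inclusion of
`{Φ ≤ 0}` witness `IsBoundaryGluing (∂X₁) (∂{Φ ≤ 0}) φ`, with the seam identity and the gluing relation
made explicit. [cite: Milnor1963, Thm. 3.1] -/
theorem exists_gluing (hemb : Manifold.IsSmoothEmbedding (𝓡∂ 4) (𝓡 4) ∞ jX₁)
    (hsub : ∀ p, 0 ≤ Φ p ↔ p ∈ range jX₁) :
    ∃ φ : (BoundaryManifold.boundaryData 3 X₁).carrier ≃ₘ⟮𝓡 3, 𝓡 3⟯ (RegularSublevel.boundaryData hΦ).carrier,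
      IsBoundaryGluing (BoundaryManifold.boundaryData 3 X₁) (RegularSublevel.boundaryData hΦ) φ (𝓡 4) M' ∧
      (∀ z, RegularSublevel.incl hΦ ((RegularSublevel.boundaryData hΦ).incl (φ z)) =
        jX₁ ((BoundaryManifold.boundaryData 3 X₁).incl z)) ∧
      range jX₁ ∪ range (RegularSublevel.incl hΦ) = univ ∧
      (∀ (q : X₁) (w : RegularSublevel hΦ), jX₁ q = RegularSublevel.incl hΦ w ↔
        ∃ z, q = (BoundaryManifold.boundaryData 3 X₁).incl z ∧ w = (RegularSublevel.boundaryData hΦ).incl (φ z)) := by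
  obtain ⟨e, he⟩ := exists_supDiffeo hΦ hemb hsub
  set b₁ := BoundaryManifold.boundaryData 3 X₁ with hb₁
  set bS := RegularSublevel.boundaryData hΦ.const_sub with hbS
  set b₂ := RegularSublevel.boundaryData hΦ with hb₂
  set φ : b₁.carrier ≃ₘ⟮𝓡 3, 𝓡 3⟯ b₂.carrier :=
    (b₁.restrictDiffeomorph bS e).trans (RegularSublevel.splitDiffeomorph hΦ).symm with hφ
  -- the seam identity
  have hseam : ∀ z, RegularSublevel.incl hΦ (b₂.incl (φ z)) = jX₁ (b₁.incl z) := by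
    intro z
    set w₁ := b₁.restrictDiffeomorph bS e z with hw₁
    have h1 : bS.incl w₁ = e (b₁.incl z) := BoundaryData.incl_restrictDiffeomorph e z
    have h2 : φ z = (RegularSublevel.splitDiffeomorph hΦ).symm w₁ := rfl
    have h3 : RegularSublevel.splitDiffeomorph hΦ (φ z) = w₁ := by rw [h2, Diffeomorph.apply_symm_apply]
    calc RegularSublevel.incl hΦ (b₂.incl (φ z))
        = RegularSublevel.incl hΦ (φ z).1 := rfl
      _ = RegularSublevel.incl hΦ.const_sub (RegularSublevel.splitDiffeomorph hΦ (φ z)).1 :=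
          (RegularSublevel.incl_splitDiffeomorph hΦ (φ z)).symm
      _ = RegularSublevel.incl hΦ.const_sub (bS.incl w₁) := by rw [h3]; rfl
      _ = jX₁ (b₁.incl z) := by rw [h1, he]
  -- the cover
  have hcover : range jX₁ ∪ range (RegularSublevel.incl hΦ) = univ := by
    refine eq_univ_of_forall fun p => ?_
    rcases le_total 0 (Φ p) with hp | hp
    · exact Or.inl ((hsub p).1 hp)
    · exact Or.inr ⟨RegularSublevel.mk hΦ p hp, rfl⟩
  -- the relation
  have hrel : ∀ (q : X₁) (w : RegularSublevel hΦ), jX₁ q = RegularSublevel.incl hΦ w ↔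
      ∃ z, q = b₁.incl z ∧ w = b₂.incl (φ z) := by
    intro q w
    constructor
    · intro hqw
      have h0 : Φ (jX₁ q) = 0 :=
        le_antisymm (hqw ▸ RegularSublevel.apply_incl_le hΦ w) ((hsub _).2 ⟨q, rfl⟩)
      have hs : e q ∈ (𝓡∂ 4).boundary (RegularSuperlevel hΦ) := by
        rw [RegularSublevel.mem_boundary_iff]
        show 0 - Φ (RegularSublevel.incl hΦ.const_sub (e q)) = 0
        rw [he, h0, sub_zero]
      have hq : q ∈ range b₁.incl := by
        have := BoundaryData.apply_incl_mem_range_incl e.symm bS b₁ ⟨e q, hs⟩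
        rwa [show bS.incl ⟨e q, hs⟩ = e q from rfl, Diffeomorph.symm_apply_apply] at this
      obtain ⟨z, rfl⟩ := hq
      refine ⟨z, rfl, RegularSublevel.injective_incl hΦ ?_⟩
      rw [← hqw, hseam]
    · rintro ⟨z, rfl, rfl⟩
      exact (hseam z).symm
  exact ⟨φ, ⟨jX₁, RegularSublevel.incl hΦ, hemb, RegularSublevel.isSmoothEmbedding_incl hΦ, hcover, hrel⟩,
    hseam, hcover, hrel⟩

omit [T2Space M'] in
/-- **Smooth maps into `M'` with values in `{Φ ≤ 0}` lift smoothly to the regular sublevel set.**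
[cite: LeeSmoothManifolds2013, Cor. 5.30] -/
theorem exists_lift_sublevel {EY HY : Type} [NormedAddCommGroup EY] [NormedSpace ℝ EY] [TopologicalSpace HY]
    (J : ModelWithCorners ℝ EY HY) {Y : Type} [TopologicalSpace Y] [ChartedSpace HY Y] {g : Y → M'}
    (hg : ContMDiff J (𝓡 4) ∞ g) (hgr : ∀ y, g y ∈ range (RegularSublevel.incl hΦ)) :
    ∃ g' : Y → RegularSublevel hΦ, ContMDiff J (𝓡∂ 4) ∞ g' ∧ ∀ y, RegularSublevel.incl hΦ (g' y) = g y := by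
  have hmem : ∀ y, g y ∈ Φ ⁻¹' Iic 0 := fun y => by
    obtain ⟨w, hw⟩ := hgr y
    rw [← hw]
    exact RegularSublevel.apply_incl_le hΦ w
  exact ⟨fun y => RegularSublevel.mk hΦ (g y) (hmem y),
    (RegularSublevel.halfSliceAtlas hΦ).contMDiff_codRestrict hmem hg, fun y => rfl⟩

end Generic

/-! ### §3 The complement piece -/

section Complement

variable {B : Type} [TopologicalSpace B] [T2Space B] [ChartedSpace (EuclideanHalfSpace 4) B]
  {ι : Type} [Finite ι] {h : ι → HandleAttachingMap 3 2 B}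
  {X : Type} [TopologicalSpace X] [ChartedSpace (EuclideanHalfSpace 4) X] [IsManifold (𝓡∂ 4) ∞ X]
  (D : MultiAttachmentData h (𝓡∂ 4) X) {ι' : Type} [Finite ι'] (f : ι' → ι)
  {bX : BoundaryData (𝓡∂ 4) X (𝓡 3)}
  {W : Type} [TopologicalSpace W] [ChartedSpace (EuclideanHalfSpace 4) W]
  [IsManifold (𝓡∂ 4) ∞ W] {bW : BoundaryData (𝓡∂ 4) W (𝓡 3)} [Nonempty bX.carrier]
  (G : BoundaryGlueData bX bW) {a κ δ : ℝ} [CompactSpace X] [T2Space X] [T2Space W] [CompactSpace W]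
  {X₁ : Type} [TopologicalSpace X₁] [CompactSpace X₁] [ChartedSpace (EuclideanHalfSpace 4) X₁]
  [IsManifold (𝓡∂ 4) ∞ X₁] {jX₁ : X₁ → G.d₂.Glued}

/-- **THE COMPLEMENT PIECE `W₂ = {Φ ≤ 0}` of the pushed prefix sub-handlebody inside Milnor's gluing
`M' = X ∪_Ψ W`, with all export clauses** (see the file header). [cite: Milnor1963, Thm. 3.1] -/
theorem exists_complementPiece (ha : 0 < a) (hf : Injective f) (hCM : ∀ j, CollarAdapted D (f j) G a)
    (hκ : 0 < κ) (hκ2 : κ ≤ 1 / 2) (hδ : 0 < δ) (hδ2 : δ ≤ 1 / 2)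
    (hemb : Manifold.IsSmoothEmbedding (𝓡∂ 4) (𝓡 4) ∞ jX₁)
    (H1 : range jX₁ ⊆ range G.jM)
    (H2 : ∀ y : X, (∀ (j : ι') (b : ↥(beltPiece 3 2)), D.jB (f j) b ≠ y) → G.jM y ∈ range jX₁)
    (H3 : ∀ (j : ι') (b : ↥(beltPiece 3 2)), G.jM (D.jB (f j) b) ∈ range jX₁ ↔
      0 < ‖lamPart ((b : closedBall (0 : EuclideanSpace ℝ (Fin 4)) 1) : EuclideanSpace ℝ (Fin 4))‖ ^ 2 ∧
        0 ≤ modelH κ δ ((b : closedBall (0 : EuclideanSpace ℝ (Fin 4)) 1) : EuclideanSpace ℝ (Fin 4))) :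
    ∃ (W₂ : Type) (_ : TopologicalSpace W₂) (_ : ChartedSpace (EuclideanHalfSpace 4) W₂)
      (_ : IsManifold (𝓡∂ 4) ∞ W₂) (_ : CompactSpace W₂) (_ : T2Space W₂) (_ : SecondCountableTopology W₂)
      (b₂ : BoundaryData (𝓡∂ 4) W₂ (𝓡 3)) (jW₂ : W₂ → G.d₂.Glued)
      (φ : (BoundaryManifold.boundaryData 3 X₁).carrier ≃ₘ⟮𝓡 3, 𝓡 3⟯ b₂.carrier),
      IsBoundaryGluing (BoundaryManifold.boundaryData 3 X₁) b₂ φ (𝓡 4) G.d₂.Glued ∧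
      Manifold.IsSmoothEmbedding (𝓡∂ 4) (𝓡 4) ∞ jW₂ ∧
      range jX₁ ∪ range jW₂ = univ ∧
      (∀ (q : X₁) (w : W₂), jX₁ q = jW₂ w ↔
        ∃ z, q = (BoundaryManifold.boundaryData 3 X₁).incl z ∧ w = b₂.incl (φ z)) ∧
      (∀ z, jW₂ (b₂.incl (φ z)) = jX₁ ((BoundaryManifold.boundaryData 3 X₁).incl z)) ∧
      range G.jN ⊆ range jW₂ ∧
      (∀ (j : ι') (b : ↥(beltPiece 3 2)), G.jM (D.jB (f j) b) ∈ range jW₂ ↔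
        modelH κ δ ((b : closedBall (0 : EuclideanSpace ℝ (Fin 4)) 1) : EuclideanSpace ℝ (Fin 4)) ≤ 0 ∨
          ‖((b : closedBall (0 : EuclideanSpace ℝ (Fin 4)) 1) : EuclideanSpace ℝ (Fin 4))‖ = 1) ∧
      (∀ y : X, (∀ (j : ι') (b : ↥(beltPiece 3 2)), D.jB (f j) b ≠ y) → (G.jM y ∈ range jW₂ ↔ ∃ z, bX.incl z = y)) ∧
      range jW₂ = range G.jN ∪ ⋃ j : ι', (fun b => G.jM (D.jB (f j) b)) ''
        {b : ↥(beltPiece 3 2) | modelH κ δ ((b : closedBall (0 : EuclideanSpace ℝ (Fin 4)) 1) : EuclideanSpace ℝ (Fin 4)) ≤ 0} ∧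
      (∀ (EY HY : Type) [NormedAddCommGroup EY] [NormedSpace ℝ EY] [TopologicalSpace HY] (J : ModelWithCorners ℝ EY HY)
        (Y : Type) [TopologicalSpace Y] [ChartedSpace HY Y] (g : Y → G.d₂.Glued),
        ContMDiff J (𝓡 4) ∞ g → (∀ y, g y ∈ range jW₂) → ∃ g' : Y → W₂, ContMDiff J (𝓡∂ 4) ∞ g' ∧ ∀ y, jW₂ (g' y) = g y) := by
  have hΦ := isRegularLevel_levelFn D f G ha hf hCM hκ hκ2 hδ hδ2 (δ := δ)
  have hsub := levelFn_nonneg_iff_mem_range D f G ha hf hCM hκ hκ2 hδ hδ2 H1 H2 H3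
  obtain ⟨φ, hglue, hseam, hcover, hrel⟩ := exists_gluing hΦ hemb hsub
  have hrange : ∀ p, p ∈ range (RegularSublevel.incl hΦ) ↔ levelFn D f G a κ δ p ≤ 0 := fun p => by
    rw [RegularSublevel.range_incl]; rfl
  -- membership tests
  have hN : range G.jN ⊆ range (RegularSublevel.incl hΦ) := by
    rintro _ ⟨c, rfl⟩
    exact (hrange _).2 (levelFn_jN_nonpos D f G ha hf hCM hκ hκ2 hδ hδ2 c)
  have hB : ∀ (j : ι') (b : ↥(beltPiece 3 2)), G.jM (D.jB (f j) b) ∈ range (RegularSublevel.incl hΦ) ↔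
      modelH κ δ ((b : closedBall (0 : EuclideanSpace ℝ (Fin 4)) 1) : EuclideanSpace ℝ (Fin 4)) ≤ 0 ∨
        ‖((b : closedBall (0 : EuclideanSpace ℝ (Fin 4)) 1) : EuclideanSpace ℝ (Fin 4))‖ = 1 := fun j b => by
    rw [hrange, levelFn_jM_jB_nonpos_iff D f G ha hf hCM hκ hκ2 hδ hδ2]
  have hA : ∀ y : X, (∀ (j : ι') (b : ↥(beltPiece 3 2)), D.jB (f j) b ≠ y) →
      (G.jM y ∈ range (RegularSublevel.incl hΦ) ↔ ∃ z, bX.incl z = y) := fun y hy => by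
    rw [hrange, levelFn_jM_of_forall_ne D f G ha hCM hκ hκ2 hy, ← collarHeightFn_eq_zero_iff']
    exact ⟨fun h' => le_antisymm h' (collarHeightFn_nonneg' _ y), fun h' => h'.le⟩
  -- the range of the inclusion
  have hR : range (RegularSublevel.incl hΦ) = range G.jN ∪ ⋃ j : ι', (fun b => G.jM (D.jB (f j) b)) ''
      {b : ↥(beltPiece 3 2) | modelH κ δ ((b : closedBall (0 : EuclideanSpace ℝ (Fin 4)) 1) : EuclideanSpace ℝ (Fin 4)) ≤ 0} := by
    apply Subset.antisymm
    · intro p hp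
      have hcov : p ∈ range G.jM ∪ range G.jN := by rw [G.range_jM_union_range_jN]; exact mem_univ _
      rcases hcov with ⟨y, rfl⟩ | hpN
      · by_cases hy : ∃ (j : ι') (b : ↥(beltPiece 3 2)), D.jB (f j) b = y
        · obtain ⟨j, b, rfl⟩ := hy
          rcases (hB j b).1 hp with hH | hn
          · exact Or.inr (mem_iUnion.2 ⟨j, b, hH, rfl⟩)
          · have hbd : D.jB (f j) b ∈ (𝓡∂ 4).boundary X := by
              rw [mem_boundary_iff_of_isSmoothEmbedding (D.hjB (f j)).1 (D.hjB (f j)).2, mem_boundary_opens_iff,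
                boundary_closedBall]
              exact hn
            rw [← bX.range_incl] at hbd
            obtain ⟨z, hz⟩ := hbd
            exact Or.inl ⟨bW.incl (G.φ z), by rw [← hz, G.jM_incl, G.jN_incl, Diffeomorph.symm_apply_apply]⟩
        · push Not at hy
          obtain ⟨z, hz⟩ := (hA y hy).1 hp
          exact Or.inl ⟨bW.incl (G.φ z), by rw [← hz, G.jM_incl, G.jN_incl, Diffeomorph.symm_apply_apply]⟩
      · exact Or.inl hpN
    · rintro p (hp | hp)
      · exact hN hp
      · obtain ⟨j, hj⟩ := mem_iUnion.1 hp
        obtain ⟨b, hb, rfl⟩ := hj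
        exact (hB j b).2 (Or.inl hb)
  exact ⟨RegularSublevel hΦ, inferInstance, inferInstance, inferInstance, inferInstance, inferInstance, inferInstance,
    RegularSublevel.boundaryData hΦ, RegularSublevel.incl hΦ, φ, hglue, RegularSublevel.isSmoothEmbedding_incl hΦ,
    hcover, hrel, hseam, hN, hB, hA, hR,
    fun EY HY _ _ _ J Y _ _ g hg hgr => exists_lift_sublevel hΦ J hg hgr⟩

/-- **Registered helper `helper_exists_complementPiece` (brick T3b (iii) of the sub-goal
`node_dual_presentation` of NF6 `stub_steinRealisation`, wave 4, lead c5): THE COMPLEMENT PIECE.**  For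
Milnor's gluing `M' = X ∪_Ψ W = G.d₂.Glued` in standard form around the belt circles of the suffix
handles `f j` and a pushed prefix embedding `jX₁ : X₁ → M'` satisfying the clauses (emb)(rng)(c')(c) of
`helper_exists_pushedPrefixEmbedding` (in the form (H1)–(H3)), there is a compact smooth `4`-manifold with
boundary `W₂` (the regular sublevel set `{Φ ≤ 0}` of the level function of files I–V), boundary data
`b₂`, a smooth embedding `jW₂ : W₂ → M'` and a diffeomorphism `φ : ∂X₁ ≅ ∂W₂` with
`IsBoundaryGluing (∂X₁) b₂ φ (𝓡 4) M'` (conjunct 1 of the node) witnessed by `jX₁`, `jW₂` themselves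
(cover, gluing relation, seam identity), `W ⊆ W₂` (`range G.jN ⊆ range jW₂`), and in each suffix handle
chart `j_M (D.jB (f j) b) ∈ W₂ ↔ modelH κ δ b ≤ 0 ∨ ‖b‖ = 1` (Z2's cocore neighbourhood `N` and the
seam sphere).  Baykur (2006), proof of Thm. 5.1 ("`M = W₁ ∪ W₂`"); Milnor (1963), Thm. 3.1.
[cite: Milnor1963, Thm. 3.1] -/
theorem helper_exists_complementPiece : ∀ {B : Type} [TopologicalSpace B] [T2Space B] [ChartedSpace (EuclideanHalfSpace 4) B] {ι : Type} [Finite ι] {h : ι → Literature.Topology.FourManifolds.HandleAttachingMap 3 2 B} {X : Type} [TopologicalSpace X] [ChartedSpace (EuclideanHalfSpace 4) X] [IsManifold (𝓡∂ 4) ∞ X] (D : Literature.Topology.FourManifolds.HandleAttachingMap.MultiAttachmentData h (𝓡∂ 4) X) {ι' : Type} [Finite ι'] (f : ι' → ι) {bX : Literature.Topology.FourManifolds.BoundaryData (𝓡∂ 4) X (𝓡 3)} {W : Type} [TopologicalSpace W] [ChartedSpace (EuclideanHalfSpace 4) W] [IsManifold (𝓡∂ 4) ∞ W] {bW : Literature.Topology.FourManifolds.BoundaryData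 (𝓡∂ 4) W (𝓡 3)} [Nonempty bX.carrier] (G : Literature.Topology.FourManifolds.BoundaryGlueData bX bW) {a κ δ : ℝ} [CompactSpace X] [T2Space X] [T2Space W] [CompactSpace W] {X₁ : Type} [TopologicalSpace X₁] [CompactSpace X₁] [ChartedSpace (EuclideanHalfSpace 4) X₁] [IsManifold (𝓡∂ 4) ∞ X₁] {jX₁ : X₁ → G.d₂.Glued}, 0 < a → Function.Injective f → (∀ j, Summit.SmoothPoincare4.SmoothPoincare4.Theorems.AcyclicBisectionExists.ModpBraidOrbits.CollarAdapted D (f j) G a) → 0 < κ → κ ≤ 1 / 2 → 0 < δ → δ ≤ 1 / 2 → Manifold.IsSmoothEmbedding (𝓡∂ 4) (𝓡 4) ∞ jX₁ → Set.range jX₁ ⊆ Set.range G.jM → (∀ y : X, (∀ (j : ι') (b : ↥(Literature.Topology.FourManifolds.beltPiece 3 2)), D.jB (f j) b ≠ y) → G.jM y ∈ Set.range jX₁) → (∀ (j : ι') (b : ↥(Literature.Topology.FourManifolds.beltPiece 3 2)), G.jM (D.jB (f j) b) ∈ Set.range jX₁ ↔ 0 < ‖Literature.Topology.FourManifolds.lamPart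 ((b : Metric.closedBall (0 : EuclideanSpace ℝ (Fin 4)) 1) : EuclideanSpace ℝ (Fin 4))‖ ^ 2 ∧ 0 ≤ Summit.SmoothPoincare4.SmoothPoincare4.Theorems.AcyclicBisectionExists.ModpBraidOrbits.modelH κ δ ((b : Metric.closedBall (0 : EuclideanSpace ℝ (Fin 4)) 1) : EuclideanSpace ℝ (Fin 4))) → ∃ (W₂ : Type) (_ : TopologicalSpace W₂) (_ : ChartedSpace (EuclideanHalfSpace 4) W₂) (_ : IsManifold (𝓡∂ 4) ∞ W₂) (_ : CompactSpace W₂) (_ : T2Space W₂) (_ : SecondCountableTopology W₂) (b₂ : Literature.Topology.FourManifolds.BoundaryData (𝓡∂ 4) W₂ (𝓡 3)) (jW₂ : W₂ → G.d₂.Glued) (φ : (Literature.Topology.FourManifolds.BoundaryManifold.boundaryData 3 X₁).carrier ≃ₘ⟮𝓡 3, 𝓡 3⟯ b₂.carrier), Literature.Topology.FourManifolds.IsBoundaryGluing (Literature.Topology.FourManifolds.BoundaryManifold.boundaryData 3 X₁) b₂ φ (𝓡 4) G.d₂.Glued ∧ Manifold.IsSmoothEmbedding (𝓡∂ 4) (𝓡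 4) ∞ jW₂ ∧ Set.range jX₁ ∪ Set.range jW₂ = Set.univ ∧ (∀ (q : X₁) (w : W₂), jX₁ q = jW₂ w ↔ ∃ z, q = (Literature.Topology.FourManifolds.BoundaryManifold.boundaryData 3 X₁).incl z ∧ w = b₂.incl (φ z)) ∧ (∀ z, jW₂ (b₂.incl (φ z)) = jX₁ ((Literature.Topology.FourManifolds.BoundaryManifold.boundaryData 3 X₁).incl z)) ∧ Set.range G.jN ⊆ Set.range jW₂ ∧ (∀ (j : ι') (b : ↥(Literature.Topology.FourManifolds.beltPiece 3 2)), G.jM (D.jB (f j) b) ∈ Set.range jW₂ ↔ Summit.SmoothPoincare4.SmoothPoincare4.Theorems.AcyclicBisectionExists.ModpBraidOrbits.modelH κ δ ((b : Metric.closedBall (0 : EuclideanSpace ℝ (Fin 4)) 1) : EuclideanSpace ℝ (Fin 4)) ≤ 0 ∨ ‖((b : Metric.closedBall (0 : EuclideanSpace ℝ (Fin 4)) 1) : EuclideanSpace ℝ (Fin 4))‖ = 1) := by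
  intro B _ _ _ ι _ h X _ _ _ D ι' _ f bX W _ _ _ bW _ G a κ δ _ _ _ _ X₁ _ _ _ _ jX₁ ha hf hCM hκ hκ2 hδ hδ2 hemb H1 H2 H3
  obtain ⟨W₂, i1, i2, i3, i4, i5, i6, b₂, jW₂, φ, hglue, hembW, hcover, hrel, hseam, hN, hB, -, -, -⟩ :=
    exists_complementPiece D f G ha hf hCM hκ hκ2 hδ hδ2 hemb H1 H2 H3
  exact ⟨W₂, i1, i2, i3, i4, i5, i6, b₂, jW₂, φ, hglue, hembW, hcover, hrel, hseam, hN, hB⟩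

end Complement

end Summit.SmoothPoincare4.SmoothPoincare4.Theorems.AcyclicBisectionExists.ModpBraidOrbits

end
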